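import Summits.RiemannHypothesis.RiemannHypothesis.Theorems.WeilWindowFlowWindowLipschitzStubGroundStateEnergy
import Summits.RiemannHypothesis.RiemannHypothesis.Theorems.WeilWindowFlowWindowLipschitzStubLocalizedCutAux2
import Summits.RiemannHypothesis.RiemannHypothesis.Theorems.OddSectorOddOneSignedWindowsFormDomainDilation
import HarnessLib

/-!
# PF persistence — pole, prime and mass parts of the dilation profile are differentiable

Support file for the crux `EvenSectorBarta.EvenOneSignedWindows` (pub-rhpf campaign, THEORY 1:
the Hadamard edge law; mechanism statements only, no claim about RH), companion of
`PfPersistenceArchVirial` (the archimedean part).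

For a square-integrable `f` vanishing at every `|x| ≥ b` and its dilates `f_η = weilDilate η f`:

* `differentiableAt_weilPoleForm_weilDilate`: `η ↦ P(f_η)` (the pole form
  `2|∫ f_η cosh(t/2)|² − 2|∫ f_η sinh(t/2)|²`) is differentiable at `η = 0` — after the substitution
  `x = (1+η)t`, `∫ f_η(t) k(t/2) dt = (1+η)^{-1/2} ∫ f(x) k(x/(2(1+η))) dx` is a parameter integral
  with smooth kernel over the compact support (dominated convergence);
* `eventually_primeEnergy_weilDilate_eq`: if every prime-power length of the window exceeds the
  support diameter (`2b < log n`), the prime part `Σ Λ(n) n^{-1/2} D_{log n}(f_η)` is CONSTANT near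
  `η = 0` (`D_t(f) = 2‖f‖²` for `t ≥ 2b`), hence has derivative `0`
  (`hasDerivAt_primeEnergy_weilDilate`);
* `hasDerivAt_mass_weilDilate`: `η ↦ ∫|f_η|²` is constant (`= ∫|f|²`, unitarity), derivative `0`.
-/

set_option linter.dupNamespace false

noncomputable section

open MeasureTheory Set Filter Metric
open scoped Topology

namespace Summit.RiemannHypothesis.RiemannHypothesis.Theorems.PfPersistence

open Literature.NumberTheory.LFunctions
open Summit.RiemannHypothesis.RiemannHypothesis.Theorems.WeilWindowFlowWindowLipschitz

/-! ## Window functions are integrable -/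

/-- An `L²` function vanishing at every `|x| ≥ b` is integrable. [folklore] -/
theorem integrable_of_memLp_of_window {f : ℝ → ℂ} {b : ℝ} (hf : MemLp f 2)
    (hfs : ∀ x, b ≤ |x| → f x = 0) : Integrable f := by
  have h1 : IntegrableOn f (Icc (-b) b) := (hf.restrict (Icc (-b) b)).integrable one_le_two
  refine h1.integrable_of_ae_notMem_eq_zero (Eventually.of_forall fun x hx ↦ hfs x ?_)
  exact (not_le.1 fun h ↦ hx (abs_le.1 h)).le

/-! ## The pole integrals along the dilation orbit -/

/-- Substitution in the pole integrals: for `η > -1` and any kernel `k`,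
`∫ f_η(t) k(t/2) dt = (1+η)^{1/2} (1+η)⁻¹ ∫ f(x) k(x/2 · (1+η)⁻¹) dx`. [folklore] -/
theorem integral_weilDilate_mul_kernel (f : ℝ → ℂ) (k : ℝ → ℝ) {η : ℝ} (hη : -1 < η) :
    ∫ t, weilDilate η f t * (k (t / 2) : ℂ) =
      (Real.sqrt (1 + η) : ℂ) * ((1 + η)⁻¹ • ∫ x, f x * (k (x / 2 * (1 + η)⁻¹) : ℂ)) := by
  have hc : 0 < 1 + η := by linarith
  have h1 : (fun t ↦ weilDilate η f t * (k (t / 2) : ℂ)) = fun t ↦ (Real.sqrt (1 + η) : ℂ) *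
      ((fun x ↦ f x * (k (x / 2 * (1 + η)⁻¹) : ℂ)) ((1 + η) * t)) := by
    funext t
    have e : (1 + η) * t / 2 * (1 + η)⁻¹ = t / 2 := by field_simp
    simp only [weilDilate_apply, e, mul_assoc]
  rw [h1, integral_const_mul, Measure.integral_comp_mul_left
    (fun x ↦ f x * (k (x / 2 * (1 + η)⁻¹) : ℂ)) (1 + η), abs_of_pos (inv_pos.2 hc)]

/-- **A parameter integral with smooth kernel over a window is differentiable.** For `f ∈ L²`
vanishing at every `|x| ≥ b` and `k : ℝ → ℝ` with continuous derivative `k'`,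
`η ↦ ∫ f(x) k(x/2 · (1+η)⁻¹) dx` is differentiable at `η = 0` (dominated convergence: the
`η`-derivative of the kernel is bounded on the support for `|η| < 1/2`). [folklore] -/
theorem differentiableAt_integral_mul_kernel {f : ℝ → ℂ} {b : ℝ} (hf : MemLp f 2)
    (hfs : ∀ x, b ≤ |x| → f x = 0) {k k' : ℝ → ℝ} (hk : ∀ y, HasDerivAt k (k' y) y)
    (hk' : Continuous k') :
    DifferentiableAt ℝ (fun η : ℝ ↦ ∫ x, f x * (k (x / 2 * (1 + η)⁻¹) : ℂ)) 0 := by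
  have hkc : Continuous k := continuous_iff_continuousAt.2 fun y ↦ (hk y).continuousAt
  have hfi : Integrable f := integrable_of_memLp_of_window hf hfs
  obtain ⟨K, hK⟩ := isCompact_Icc.exists_bound_of_continuousOn (hk'.continuousOn (s := Icc (-b) b))
  set K' : ℝ := max K 0 with hK'def
  have hK' : ∀ y ∈ Icc (-b) b, |k' y| ≤ K' := fun y hy ↦
    (Real.norm_eq_abs _ ▸ hK y hy).trans (le_max_left _ _)
  have hK0 : 0 ≤ K' := le_max_right _ _
  set F : ℝ → ℝ → ℂ := fun η x ↦ f x * (k (x / 2 * (1 + η)⁻¹) : ℂ) with hF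
  set F' : ℝ → ℝ → ℂ :=
    fun η x ↦ f x * ((k' (x / 2 * (1 + η)⁻¹) * (x / 2 * (-1 / (1 + η) ^ 2)) : ℝ) : ℂ) with hF'
  -- measurability of `F η`
  have hFm : ∀ η, AEStronglyMeasurable (F η) volume := fun η ↦
    hf.1.mul (Complex.continuous_ofReal.comp (hkc.comp ((continuous_id.div_const 2).mul
      continuous_const))).aestronglyMeasurable
  -- `F η` vanishes off the window, hence is integrable
  have hFint : ∀ η, Integrable (F η) := fun η ↦ by
    have h1 : IntegrableOn (F η) (Icc (-b) b) :=
      (hfi.integrableOn).mul_continuousOn ((Complex.continuous_ofReal.comp (hkc.comp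
        ((continuous_id.div_const 2).mul continuous_const))).continuousOn) isCompact_Icc
    refine h1.integrable_of_ae_notMem_eq_zero (Eventually.of_forall fun x hx ↦ ?_)
    simp only [hF, hfs x (not_le.1 fun h ↦ hx (abs_le.1 h)).le, zero_mul]
  have hF'm : AEStronglyMeasurable (F' 0) volume :=
    hf.1.mul (Complex.continuous_ofReal.comp ((hk'.comp ((continuous_id.div_const 2).mul
      continuous_const)).mul ((continuous_id.div_const 2).mul continuous_const))).aestronglyMeasurable
  -- domination: `‖F' η x‖ ≤ ‖f x‖ · 2K'b… ` for `|η| < 1/2`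
  have h_bound : ∀ᵐ x ∂volume, ∀ η ∈ ball (0 : ℝ) (1 / 2), ‖F' η x‖ ≤ ‖f x‖ * (K' * (2 * |b|)) :=
    Eventually.of_forall fun x η hη ↦ by
      have hη' : |η| < 1 / 2 := by simpa [Real.dist_eq] using hη
      have hc1 : 1 / 2 < 1 + η := by linarith [(abs_lt.1 hη').1]
      have hc : 0 < 1 + η := by linarith
      by_cases hx : b ≤ |x|
      · simp [hF', hfs x hx]
      · have hxb : |x| < b := not_le.1 hx
        have hb : 0 < b := (abs_nonneg x).trans_lt hxb
        have hinv : (1 + η)⁻¹ ≤ 2 := by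
          rw [inv_le_comm₀ hc (by norm_num)]
          linarith
        have hy : x / 2 * (1 + η)⁻¹ ∈ Icc (-b) b := by
          rw [mem_Icc, ← abs_le]
          rw [abs_mul, abs_of_pos (inv_pos.2 hc), abs_div, abs_two]
          nlinarith [abs_nonneg x, inv_pos.2 hc]
        have h1 : |k' (x / 2 * (1 + η)⁻¹)| ≤ K' := hK' _ hy
        have hsq : ((1 + η) ^ 2)⁻¹ ≤ 4 := by
          rw [inv_le_comm₀ (by positivity) (by norm_num)]
          nlinarith
        have h2 : |x / 2 * (-1 / (1 + η) ^ 2)| ≤ 2 * |b| := by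
          rw [abs_mul, abs_div, abs_two, abs_div, abs_neg, abs_one, abs_of_pos (by positivity :
            (0:ℝ) < (1 + η) ^ 2), one_div, abs_of_pos hb]
          nlinarith [abs_nonneg x, inv_pos.2 (by positivity : (0:ℝ) < (1 + η) ^ 2)]
        have hn : ‖F' η x‖ = ‖f x‖ * (|k' (x / 2 * (1 + η)⁻¹)| * |x / 2 * (-1 / (1 + η) ^ 2)|) := by
          simp only [hF', norm_mul, Complex.norm_real, Real.norm_eq_abs, Complex.ofReal_mul, abs_mul]
        rw [hn]
        exact mul_le_mul_of_nonneg_left (mul_le_mul h1 h2 (abs_nonneg _) hK0) (norm_nonneg _)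
  -- pointwise derivative
  have h_diff : ∀ᵐ x ∂volume, ∀ η ∈ ball (0 : ℝ) (1 / 2),
      HasDerivAt (fun η ↦ F η x) (F' η x) η :=
    Eventually.of_forall fun x η hη ↦ by
      have hη' : |η| < 1 / 2 := by simpa [Real.dist_eq] using hη
      have hc : 0 < 1 + η := by linarith [(abs_lt.1 hη').1]
      have h1 : HasDerivAt (fun η : ℝ ↦ (1 + η)⁻¹) (-(1 : ℝ) / (1 + η) ^ 2) η :=
        ((hasDerivAt_id' η).const_add 1).inv hc.ne'
      have h2 := h1.const_mul (x / 2)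
      have h3 := (((hk _).comp η h2).ofReal_comp).const_mul (f x)
      simpa only [hF, hF', Function.comp_def] using h3
  have key := hasDerivAt_integral_of_dominated_loc_of_deriv_le (μ := volume) (F := F) (F' := F')
    (x₀ := 0) (bound := fun x ↦ ‖f x‖ * (K' * (2 * |b|)))
    (ball_mem_nhds (0 : ℝ) (by norm_num : (0 : ℝ) < 1 / 2)) (Eventually.of_forall hFm) (hFint 0)
    hF'm h_bound (hfi.norm.mul_const _) h_diff
  exact key.2.differentiableAt

/-- **The pole form is differentiable along the dilation orbit of a window function.**
[folklore] -/
theorem differentiableAt_weilPoleForm_weilDilate {f : ℝ → ℂ} {b : ℝ} (hf : MemLp f 2)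
    (hfs : ∀ x, b ≤ |x| → f x = 0) :
    DifferentiableAt ℝ (fun η : ℝ ↦ weilPoleForm (weilDilate η f)) 0 := by
  have hpre : DifferentiableAt ℝ (fun η : ℝ ↦ ((Real.sqrt (1 + η) : ℝ) : ℂ)) 0 :=
    ((DifferentiableAt.sqrt (by fun_prop) (by norm_num) :
      DifferentiableAt ℝ (fun η : ℝ ↦ Real.sqrt (1 + η)) 0).hasDerivAt.ofReal_comp).differentiableAt
  have hinv : DifferentiableAt ℝ (fun η : ℝ ↦ (1 + η)⁻¹) 0 :=
    DifferentiableAt.inv (by fun_prop) (by norm_num)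
  have hmain : ∀ {k k' : ℝ → ℝ}, (∀ y, HasDerivAt k (k' y) y) → Continuous k' →
      DifferentiableAt ℝ (fun η : ℝ ↦ ‖∫ t, weilDilate η f t * (k (t / 2) : ℂ)‖ ^ 2) 0 := by
    intro k k' hk hk'
    have hI := differentiableAt_integral_mul_kernel hf hfs hk hk'
    have hA : DifferentiableAt ℝ (fun η : ℝ ↦ (Real.sqrt (1 + η) : ℂ) *
        ((1 + η)⁻¹ • ∫ x, f x * (k (x / 2 * (1 + η)⁻¹) : ℂ))) 0 := hpre.mul (hinv.smul hI)
    have hev : (fun η : ℝ ↦ ∫ t, weilDilate η f t * (k (t / 2) : ℂ)) =ᶠ[𝓝 0] fun η ↦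
        (Real.sqrt (1 + η) : ℂ) * ((1 + η)⁻¹ • ∫ x, f x * (k (x / 2 * (1 + η)⁻¹) : ℂ)) := by
      filter_upwards [Ioi_mem_nhds (show (-1 : ℝ) < 0 by norm_num)] with η hη
      exact integral_weilDilate_mul_kernel f k hη
    exact (hA.congr_of_eventuallyEq hev).norm_sq ℝ
  have hc := hmain (fun y ↦ by simpa using (Real.hasDerivAt_cosh (y)))
    Real.continuous_sinh
  have hs := hmain (fun y ↦ by simpa using (Real.hasDerivAt_sinh (y)))
    Real.continuous_cosh
  unfold weilPoleForm
  exact (hc.const_mul 2).sub (hs.const_mul 2)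

/-! ## The prime part is locally constant, the mass is constant -/

/-- If every prime-power length `log n` (`n ≥ 2`) of the index exceeds the support diameter `2b`,
the prime part of the Dirichlet energy is constant along the dilation orbit near `η = 0`
(`D_t(f_η) = D_{(1+η)t}(f) = 2‖f‖² = D_t(f)` for `(1+η) t ≥ 2b`, `t ≥ 2b`). [folklore] -/
theorem eventually_primeEnergy_weilDilate_eq {f : ℝ → ℂ} {b A : ℝ} (hf : MemLp f 2)
    (hfs : ∀ x, b ≤ |x| → f x = 0) (hA : ∀ n ∈ weilPrimeIndex A, 2 ≤ n → 2 * b < Real.log n) :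
    ∀ᶠ η : ℝ in 𝓝 0,
      (∑ n ∈ weilPrimeIndex A, ArithmeticFunction.vonMangoldt n / Real.sqrt n *
          weilIncrement (weilDilate η f) (Real.log n)) =
        ∑ n ∈ weilPrimeIndex A, ArithmeticFunction.vonMangoldt n / Real.sqrt n *
          weilIncrement f (Real.log n) := by
  have hev : ∀ᶠ η : ℝ in 𝓝 0, ∀ n ∈ weilPrimeIndex A, 2 ≤ n → 2 * b < (1 + η) * Real.log n := by
    refine (Finset.eventually_all (weilPrimeIndex A)).2 fun n hn ↦ ?_
    by_cases h2 : 2 ≤ n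
    · have hcont : Continuous fun η : ℝ ↦ (1 + η) * Real.log n := by fun_prop
      have h0 : 2 * b < (1 + (0:ℝ)) * Real.log n := by simpa using hA n hn h2
      exact (Filter.Tendsto.eventually_const_lt h0 hcont.continuousAt).mono fun η h _ ↦ h
    · exact Eventually.of_forall fun η h ↦ absurd h h2
  filter_upwards [hev, Ioi_mem_nhds (show (-1 : ℝ) < 0 by norm_num)] with η hη hη1
  refine Finset.sum_congr rfl fun n hn ↦ ?_
  rw [weilIncrement_weilDilate f hη1]
  rcases Nat.lt_or_ge n 2 with h2 | h2
  · interval_cases n <;> simp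
  · rw [stub_localizedCut_weilIncrement_eq_two_mul hf hfs (hη n hn h2).le,
      stub_localizedCut_weilIncrement_eq_two_mul hf hfs (hA n hn h2).le]

/-- Under the hypothesis of `eventually_primeEnergy_weilDilate_eq` the prime part has derivative
`0` along the dilation orbit. [folklore] -/
theorem hasDerivAt_primeEnergy_weilDilate {f : ℝ → ℂ} {b A : ℝ} (hf : MemLp f 2)
    (hfs : ∀ x, b ≤ |x| → f x = 0) (hA : ∀ n ∈ weilPrimeIndex A, 2 ≤ n → 2 * b < Real.log n) :
    HasDerivAt (fun η : ℝ ↦ ∑ n ∈ weilPrimeIndex A, ArithmeticFunction.vonMangoldt n / Real.sqrt n *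
        weilIncrement (weilDilate η f) (Real.log n)) 0 0 :=
  (hasDerivAt_const (0 : ℝ) (∑ n ∈ weilPrimeIndex A, ArithmeticFunction.vonMangoldt n /
    Real.sqrt n * weilIncrement f (Real.log n))).congr_of_eventuallyEq
    (eventually_primeEnergy_weilDilate_eq hf hfs hA)

/-- The mass `∫|f_η|² = ∫|f|²` is constant along the dilation orbit: derivative `0`. [folklore] -/
theorem hasDerivAt_mass_weilDilate (f : ℝ → ℂ) :
    HasDerivAt (fun η : ℝ ↦ ∫ x, ‖weilDilate η f x‖ ^ 2) 0 0 :=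
  (hasDerivAt_const (0 : ℝ) (∫ x, ‖f x‖ ^ 2)).congr_of_eventuallyEq (by
    filter_upwards [Ioi_mem_nhds (show (-1 : ℝ) < 0 by norm_num)] with η hη
    exact integral_norm_sq_weilDilate f hη)

end Summit.RiemannHypothesis.RiemannHypothesis.Theorems.PfPersistence

end
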